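import Literature.AnabelianGeometry.SemiGraphs.Pullback
import Mathlib.SetTheory.Cardinal.Finite

/-!
# Semi-graphs: the two branches of an edge and the bijections `e ⥲ e'` ([SemiAnbd] §1 p.11)

Mochizuki, *Semi-graphs of anabelioids*, Publ. RIMS **42** (2006), §1 p.11: an edge `e` "is a set
of cardinality 2" (its branches), and a morphism of semi-graphs comes with, "for each edge `e ↦ e'`,
a bijection `e ⥲ e'`" (kurims `paper:url-f33ace170ff4`). [cite: MochizukiSemiAnbd2006, §1, p. 11]

Bookkeeping over t1's `SemiGraph.lean` (field `two_branches`) and `Pullback.lean`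
(`Hom.exists_branchMap_eq`), PROVED (merge-pass input for the §§4–5 container fields `Br`,
`natCard_br`, `mapBr`, `mapBr_bijective`, `abut_mapBr` of `InterfaceVocab.lean`):
`SemiGraph.branchesOf e` (the type of branches of `e`), `natCard_branchesOf` (`= 2`),
`Hom.branchesOfMap` (the map `e → f e` on branches) and `Hom.branchesOfMap_bijective`.
-/

namespace Literature.AnabelianGeometry.SemiGraphs

namespace SemiGraph

open CategoryTheory

universe u

variable (G : SemiGraph.{u})

/-- The branches of the edge `e` (§1 p.11: an edge "is a set of cardinality 2").
[cite: MochizukiSemiAnbd2006, §1, p. 11] -/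
abbrev branchesOf (e : G.Edge) : Type u := {b : G.Branch // G.edgeOf b = e}

/-- An edge has exactly two branches (§1 (2) p.11). [cite: MochizukiSemiAnbd2006, §1, p. 11] -/
theorem natCard_branchesOf (e : G.Edge) : Nat.card (G.branchesOf e) = 2 := by
  obtain ⟨b₁, b₂, hne, h₁, h₂, hall⟩ := G.two_branches e
  have hequiv : G.branchesOf e ≃ Bool :=
    { toFun := fun b => by classical exact decide (b.1 = b₁)
      invFun := fun t => if t then ⟨b₁, h₁⟩ else ⟨b₂, h₂⟩
      left_inv := fun b => by
        classical
        rcases hall b.1 b.2 with h | h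
        · simp only [h, decide_true, if_true]; exact Subtype.ext h.symm
        · have hb : b.1 ≠ b₁ := by rw [h]; exact hne.symm
          simp only [hb, decide_false]; exact Subtype.ext h.symm
      right_inv := fun t => by
        classical
        cases t
        · simp [hne.symm]
        · simp }
  rw [Nat.card_congr hequiv, Nat.card_eq_fintype_card, Fintype.card_bool]

variable {G} {G' : SemiGraph.{u}}

/-- The map `e → f e` on branches induced by a morphism of semi-graphs (§1 p.11 "a bijection
`e ⥲ e'`"). [cite: MochizukiSemiAnbd2006, §1, p. 11] -/
def Hom.branchesOfMap (f : G ⟶ G') (e : G.Edge) : G.branchesOf e → G'.branchesOf (f.edgeMap e) :=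
  fun b => ⟨f.branchMap b.1, by rw [f.edgeOf_branchMap, b.2]⟩

/-- The underlying branch of the image. [cite: MochizukiSemiAnbd2006, §1, p. 11] -/
@[simp] theorem Hom.branchesOfMap_val (f : G ⟶ G') (e : G.Edge) (b : G.branchesOf e) :
    (Hom.branchesOfMap f e b).1 = f.branchMap b.1 := rfl

/-- `e → f e` is a bijection of branches (§1 p.11). [cite: MochizukiSemiAnbd2006, §1, p. 11] -/
theorem Hom.branchesOfMap_bijective (f : G ⟶ G') (e : G.Edge) :
    Function.Bijective (Hom.branchesOfMap f e) := by
  constructor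
  · intro b₁ b₂ h
    exact Subtype.ext (f.branchMap_injOn b₁.1 b₂.1 (b₁.2.trans b₂.2.symm)
      (congrArg Subtype.val h))
  · intro c
    obtain ⟨b, hb, hbc⟩ := Hom.exists_branchMap_eq f e c.1 c.2
    exact ⟨⟨b, hb⟩, Subtype.ext hbc⟩

/-- A branch of `e` abutting to `v` goes to a branch of `f e` abutting to `f v` (§1 p.11,
compatibility with the coincidence maps). [cite: MochizukiSemiAnbd2006, §1, p. 11] -/
theorem Hom.abuts_branchesOfMap (f : G ⟶ G') {e : G.Edge} (b : G.branchesOf e) (v : G.Vertex)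
    (h : G.abuts b.1 = some v) : G'.abuts (Hom.branchesOfMap f e b).1 = some (f.vertexMap v) :=
  f.abuts_branchMap b.1 v h

end SemiGraph

end Literature.AnabelianGeometry.SemiGraphs
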